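import Mathlib
import Summits.ValiantsHypothesis.ValiantsHypothesis.Theses.ValuativeGCT
import Summits.ValiantsHypothesis.ValiantsHypothesis.Theorems.ValuativeGCTValuativeFlipFreshPaddingInheritance
import Summits.ValiantsHypothesis.ValiantsHypothesis.Theorems.ValuativeGCTValuativeFlipDetEventualMonotone
import Summits.ValiantsHypothesis.ValiantsHypothesis.Theorems.ValuativeGCTValuativeFlipDiagonalInheritance
import Summits.ValiantsHypothesis.ValiantsHypothesis.Theorems.ValuativeGCTValuativeBound
import Summits.ValiantsHypothesis.ValiantsHypothesis.Theorems.ValuativeGCTGctMultPrinciple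

/-!
# Border determinantal membership of the padded permanent is monotone in the matrix size —
# size-transfer axis, part V (the `m ↦ m + j` transfer of MEMBERSHIP)

Wall-breaker k12/16 (axis "representation-stability transfer between `m` and `m + 1`"), seat 4,
2026-08-16, crux `ValuativeGCT.ValuativeFlip` (stmt-ValiantsHypothesis-12624).  Parts I–IV of the axis
transfer MULTIPLICITIES (inner monotonicity, twisted/eventual/diagonal/fresh-letter inheritance) and
the flip body (steep edges, window columns); the one object of the route that had no `m ↦ m + 1`
transfer in the tree is the conclusion the flips serve — border determinantal MEMBERSHIP
`HasBorderDetRepr k n m : X₀₀^{m-n} per_n ∈ Δ(det_m)`, whose infimum `borderDetComplexityPer` was so far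
only known to be attained, not to be a threshold.  This file proves the transfer:

* `fresh_padding_mem_orbitClosure_of_mem` — **fresh padding is functorial on degenerations**:
  `g ∈ Δ_m(f) ⇒ X_y^j · ι(g) ∈ Δ_N(X_y^j · ι(f))` for `y` off the segment (pull back test polynomials
  along the coefficient-linear map `g ↦ X_y^j ι(g)`, `bpm_aeval_pullback`; the map intertwines the
  actions up to `End`, `exists_linSubst_fresh_padding`).  The same-letter map `g ↦ x · g` does NOT
  intertwine the action — the source of every failure of same-letter padding monotonicity for
  multiplicities (`padding_step_monotonicity_fails`, k12 gen 1) — but for MEMBERSHIP the fresh letter can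
  be merged afterwards, because merging is a degeneration in the right direction:
* `paddedPerFormLex_mem_endOrbit_fresh_padding` — `X₀₀^{m+j-n} per_n` is a relabeling (a `0/1`
  substitution) of `X₀₀^j · ι(X₀₀^{m-n} per_n)`;
* `X_pow_mul_rename_detFormLex_mem_orbitClosure` — `X_y^j · ι(det_m) ∈ Δ(det_{m+j})` for every placement
  (Mulmuley–Sohoni Prop. 4.4);
* `paddedPerFormLex_mem_orbitClosure_detFormLex_mono`, **`hasBorderDetRepr_mono`** — hence
  `X₀₀^{m-n} per_n ∈ Δ(det_m) ⇒ X₀₀^{m'-n} per_n ∈ Δ(det_{m'})` for all `n ≤ m ≤ m'`;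
  `not_hasBorderDetRepr_anti` (non-membership propagates DOWN in `m`);
  `hasBorderDetRepr_iff_borderDetComplexityPer_le` — `dc̲(per_n)` is a threshold:
  `HasBorderDetRepr ℂ n m ↔ dc̲(per_n) ≤ m` (`n ≤ m`).

Consequences for the route's window statements: a valuative flip at `(n, m)` certifies
`X₀₀^{m'-n} per_n ∉ Δ(det_{m'})` at EVERY `n ≤ m' ≤ m` (`not_hasBorderDetRepr_of_flipBody_of_le`); the
hypothesis of the bridge `GctToVH` (non-membership at every window position) is equivalent to
non-membership at the TOP of each window column only (`forall_window_not_hasBorderDetRepr_iff_top`), so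
`VP ≠ VNP` follows from ONE non-membership per inner size (`valiantsHypothesis_of_top_not_hasBorderDetRepr`),
equivalently from `W_c(n) < dc̲(per_n)` eventually in `n` for every `c`
(`valiantsHypothesis_of_window_lt_borderDetComplexityPer`).  Contrast: the MULTIPLICITY flip body has no
such transfer between levels (k12 gens 0–2, k16: both sides are co-monotone along row lifts), which is
why `ValuativeFlip` keeps every level `m` while its membership shadow needs only the top one.

Sources: Mulmuley–Sohoni 2001 §4 (Prop. 4.4, padding and `End`-orbits); Landsberg 2017 §6.2;
Bürgisser–Ikenmeyer–Panova 2019 §1(a); this crux's `…FreshPaddingInheritance` (k12 seat 3),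
`…DetEventualMonotone` (k16), `…DiagonalInheritance` (k12 seat 3).
-/

set_option linter.dupNamespace false

namespace Summit.ValiantsHypothesis.ValiantsHypothesis.Theorems.ValuativeFlip

open scoped BigOperators Matrix
open MvPolynomial
open Literature.NumberTheory.DiophantineGeometry
open Literature.Computability.AlgebraicComplexity
open Literature.Computability.Complexity

noncomputable section

/-! ## Fresh padding is functorial on degenerations (Zariski continuity of `g ↦ X_y^j · ι(g)`) -/

/-- Coefficients of a fresh padding, on the shifted exponents: the coefficient of
`y^j · ι(d)` in `X_y^j · ι(h)` is the coefficient of `d` in `h`. [folklore] -/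
theorem bpm_coeff_fresh_padding_of_eq {m N : ℕ} (hmN : m ≤ N) (y : MatIdx N) (j : ℕ)
    (h : MvPolynomial (MatIdx m) ℂ) (d : MatIdx m →₀ ℕ) :
    coeff (Finsupp.single y j + Finsupp.mapDomain (segEmb hmN) d)
      (X y ^ j * rename (segEmb hmN) h) = coeff d h := by
  rw [X_pow_eq_monomial, coeff_monomial_mul', if_pos le_self_add, one_mul, add_tsub_cancel_left,
    coeff_rename_mapDomain _ (segEmb_strictMono hmN).injective]

/-- Coefficients of a fresh padding, off the shifted exponents: zero. [folklore] -/
theorem bpm_coeff_fresh_padding_of_ne {m N : ℕ} (hmN : m ≤ N) (y : MatIdx N) (j : ℕ)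
    (h : MvPolynomial (MatIdx m) ℂ) (d' : MatIdx N →₀ ℕ)
    (hd' : ¬ ∃ d : MatIdx m →₀ ℕ, d' = Finsupp.single y j + Finsupp.mapDomain (segEmb hmN) d) :
    coeff d' (X y ^ j * rename (segEmb hmN) h) = 0 := by
  rw [X_pow_eq_monomial, coeff_monomial_mul']
  split_ifs with hle
  · rw [one_mul]
    apply coeff_rename_eq_zero
    intro u hu
    exfalso
    exact hd' ⟨u, by rw [hu, add_tsub_cancel_of_le hle]⟩
  · rfl

open Classical in
/-- **Pull-back of test polynomials along a fresh padding.**  The map `g ↦ X_y^j · ι(g)` is linear on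
coefficient vectors — each coefficient of the image is a coefficient of `g` or zero — so a test
polynomial `p` on the coefficient space of level `N` pulls back to the test polynomial
`p ∘ (X_y^j · ι(·))` on the coefficient space of level `m` (substitute `X_d` for the coordinate of
`y^j ι(d)` and `0` for the other coordinates). [Mulmuley–Sohoni 2001 §4; folklore] -/
theorem bpm_aeval_pullback {m N : ℕ} (hmN : m ≤ N) (y : MatIdx N) (j : ℕ)
    (h : MvPolynomial (MatIdx m) ℂ) (p : MvPolynomial (MatIdx N →₀ ℕ) ℂ) :
    aeval (coeffVec h) (aeval (fun d' : MatIdx N →₀ ℕ =>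
        if hd : ∃ d : MatIdx m →₀ ℕ, d' = Finsupp.single y j + Finsupp.mapDomain (segEmb hmN) d
        then (X hd.choose : MvPolynomial (MatIdx m →₀ ℕ) ℂ) else 0) p) =
      aeval (coeffVec (X y ^ j * rename (segEmb hmN) h)) p := by
  classical
  rw [← AlgHom.comp_apply, comp_aeval]
  refine congrArg (fun F : (MatIdx N →₀ ℕ) → ℂ => aeval F p) (funext fun d' => ?_)
  by_cases hd : ∃ d : MatIdx m →₀ ℕ, d' = Finsupp.single y j + Finsupp.mapDomain (segEmb hmN) d
  · rw [dif_pos hd, aeval_X, coeffVec_apply, coeffVec_apply]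
    have e := hd.choose_spec
    calc coeff hd.choose h
        = coeff (Finsupp.single y j + Finsupp.mapDomain (segEmb hmN) hd.choose)
            (X y ^ j * rename (segEmb hmN) h) := (bpm_coeff_fresh_padding_of_eq hmN y j h _).symm
      _ = coeff d' (X y ^ j * rename (segEmb hmN) h) := by rw [← e]
  · rw [dif_neg hd, map_zero, coeffVec_apply, bpm_coeff_fresh_padding_of_ne hmN y j h d' hd]

/-- **Fresh padding is functorial on degenerations.**  For `y` off the segment `ι(MatIdx m)` and any
`j`: `g ∈ Δ_m(f) ⇒ X_y^j · ι(g) ∈ Δ_N(X_y^j · ι(f))`.  A test polynomial `p` vanishing on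
`GL · (X_y^j ι f)` vanishes on `Δ(X_y^j ι f)`, which contains `X_y^j ι(A · f) = B · (X_y^j ι f)` for every
`A` (`exists_linSubst_fresh_padding`: act by `A` on the segment, fix `y`); so the pull-back
`p ∘ (X_y^j ι(·))` (`bpm_aeval_pullback`) vanishes on `GL · f`, hence at `g`.  (The same-letter
analogue is false: `x ↦ x·g` does not intertwine the action.) [Mulmuley–Sohoni 2001 §4; folklore] -/
theorem fresh_padding_mem_orbitClosure_of_mem {m N : ℕ} (hmN : m ≤ N) (y : MatIdx N)
    (hy : ∀ r : MatIdx m, segEmb hmN r ≠ y) (j : ℕ) {f g : MvPolynomial (MatIdx m) ℂ}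
    (hg : g ∈ orbitClosure f) :
    X y ^ j * rename (segEmb hmN) g ∈ orbitClosure (X y ^ j * rename (segEmb hmN) f) := by
  classical
  rw [mem_orbitClosure_iff] at hg ⊢
  intro p hp
  rw [← bpm_aeval_pullback hmN y j g p]
  apply hg
  intro h hh
  obtain ⟨A, rfl⟩ := hh
  dsimp only
  rw [bpm_aeval_pullback hmN y j _ p]
  obtain ⟨B, hB⟩ := exists_linSubst_fresh_padding hmN y hy (A : Matrix (MatIdx m) (MatIdx m) ℂ) j
  have hmem : X y ^ j * rename (segEmb hmN) (linSubstRep (MatIdx m) ℂ A f) ∈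
      orbitClosure (X y ^ j * rename (segEmb hmN) f) := by
    rw [linSubstRep_apply, ← hB f]
    exact linSubst_mem_orbitClosure_of_mem (mem_orbitClosure_self _) B
  exact (mem_orbitClosure_iff.mp hmem) p hp

/-! ## Freshly padded determinants are degenerations of the bigger determinant -/

/-- **`X_y^j · ι(det_m) ∈ Δ(det_{m+j})` for EVERY placement `ι` of the variables and every padding
variable `y`** (Mulmuley–Sohoni's homogenisation `X_pow_mul_rename_mem_endOrbit_detPoly` applied to
`det_m`, which is its own affine determinantal representation, padded to size `m + j`; then
`End · det ⊆ Δ(det)` and transport to the lexicographic variables).  The instance `ι = segEmb`,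
`y = X_top` is `paddedForm_mem_orbitClosure_detFormLex`. [Mulmuley–Sohoni 2001 Prop. 4.4] -/
theorem X_pow_mul_rename_detFormLex_mem_orbitClosure (m j : ℕ) [NeZero (m + j)]
    (ι : MatIdx m → MatIdx (m + j)) (y : MatIdx (m + j)) :
    X y ^ j * rename ι (detFormLex ℂ m) ∈ orbitClosure (detFormLex ℂ (m + j)) := by
  classical
  have hA : HasDetRepr (detFormLex ℂ m) (m + j) :=
    HasDetRepr.mono_holds (hasDetRepr_detFormLex m) (Nat.le_add_right m j)
  have hmem := X_pow_mul_rename_mem_endOrbit_detPoly (k := ℂ) (detFormLex_isHomogeneous ℂ m)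
    (Nat.le_add_right m j) hA (fun x => ofLex (ι x)) (ofLex y)
  have hcl := endOrbit_subset_orbitClosure_holds _ hmem
  have hren : rename (toLex : Fin (m + j) × Fin (m + j) → MatIdx (m + j))
      (X (ofLex y) ^ (m + j - m) * rename (fun x => ofLex (ι x)) (detFormLex ℂ m)) =
        X y ^ j * rename ι (detFormLex ℂ m) := by
    rw [map_mul, map_pow, rename_X, toLex_ofLex, rename_rename, Nat.add_sub_cancel_left]
    rfl
  rw [← hren]
  exact (rename_mem_orbitClosure_rename_iff_holds toLex (detPoly (Fin (m + j)) ℂ) _).2 hcl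

/-! ## Merging the fresh letter: `X₀₀^{m+j-n} per_n` is a relabeling of `X₀₀^j · ι(X₀₀^{m-n} per_n)` -/

/-- **The padded permanent of the bigger level is an `End`-point of the freshly padded smaller one.**
For `n ≤ m` and `j ≥ 1`, `X₀₀^{m+j-n} per_n` (level `m + j`) is obtained from
`X₀₀^j · ι(X₀₀^{m-n} per_n)` (`ι` the final-segment embedding of the level-`m` variables; `X₀₀` of
level `m + j` is off the segment) by a relabeling of variables: send the segment copies of the inner
block to the block of level `m + j` along the two enumerations, and every other variable — in
particular the segment copy of the level-`m` padding variable — to `X₀₀`.  Renamings are `0/1`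
substitutions (`rename_mem_endOrbit`). [Mulmuley–Sohoni 2001 §4; folklore] -/
theorem paddedPerFormLex_mem_endOrbit_fresh_padding {n m : ℕ} [NeZero m] (hnm : n ≤ m) (j : ℕ)
    [NeZero (m + j)] (hj : 1 ≤ j) :
    paddedPerFormLex ℂ n (m + j) ∈ endOrbit (MatIdx (m + j)) ℂ
      ((X (toLex ((0 : Fin (m + j)), (0 : Fin (m + j)))) : MvPolynomial (MatIdx (m + j)) ℂ) ^ j *
        rename (segEmb (Nat.le_add_right m j)) (paddedPerFormLex ℂ n m)) := by
  classical
  have hnN : n ≤ m + j := hnm.trans (Nat.le_add_right m j)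
  -- enumerations of the two blocks and the induced placements of `per_n`
  let e₀ : Fin n ≃ BlockIdx n m := (Fintype.equivFinOfCardEq (card_blockIdx hnm)).symm
  let e₁ : Fin n ≃ BlockIdx n (m + j) := (Fintype.equivFinOfCardEq (card_blockIdx hnN)).symm
  let G₀ : Fin n × Fin n → MatIdx m := fun ab =>
    toLex (((e₀ ab.1 : BlockIdx n m) : Fin m), ((e₀ ab.2 : BlockIdx n m) : Fin m))
  let G₁ : Fin n × Fin n → MatIdx (m + j) := fun ab =>
    toLex (((e₁ ab.1 : BlockIdx n (m + j)) : Fin (m + j)), ((e₁ ab.2 : BlockIdx n (m + j)) : Fin (m + j)))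
  set ι : MatIdx m → MatIdx (m + j) := segEmb (Nat.le_add_right m j) with hι
  set y : MatIdx (m + j) := toLex ((0 : Fin (m + j)), (0 : Fin (m + j))) with hy
  have hιinj : Function.Injective ι := (segEmb_strictMono (Nat.le_add_right m j)).injective
  have hinj₀ : Function.Injective G₀ := by
    intro ab ab' h
    have h1 := congrArg (fun x : MatIdx m => (ofLex x).1) h
    have h2 := congrArg (fun x : MatIdx m => (ofLex x).2) h
    simp only [G₀, ofLex_toLex] at h1 h2
    exact Prod.ext (e₀.injective (Subtype.ext h1)) (e₀.injective (Subtype.ext h2))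
  -- the relabeling
  let ρ : MatIdx (m + j) → MatIdx (m + j) := fun v =>
    if h : ∃ ab, ι (G₀ ab) = v then G₁ h.choose else y
  have hρG : ∀ ab, ρ (ι (G₀ ab)) = G₁ ab := by
    intro ab
    have hex : ∃ ab', ι (G₀ ab') = ι (G₀ ab) := ⟨ab, rfl⟩
    have hch : hex.choose = ab := hinj₀ (hιinj hex.choose_spec)
    show (if h : ∃ ab', ι (G₀ ab') = ι (G₀ ab) then G₁ h.choose else y) = G₁ ab
    rw [dif_pos hex, hch]
  have hρy : ρ y = y := by
    have hne : ¬ ∃ ab, ι (G₀ ab) = y := fun ⟨ab, hab⟩ => toLex_zero_not_mem_segEmb hj (G₀ ab) hab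
    show (if h : ∃ ab, ι (G₀ ab) = y then G₁ h.choose else y) = y
    rw [dif_neg hne]
  -- the padding variable of level `m` is relabeled to `y` (or carries exponent `0` when `n = m`)
  have hρx : (X (ρ (ι (toLex ((0 : Fin m), (0 : Fin m))))) : MvPolynomial (MatIdx (m + j)) ℂ) ^ (m - n) =
      X y ^ (m - n) := by
    rcases hnm.lt_or_eq with hlt | heq
    · have hne : ¬ ∃ ab, ι (G₀ ab) = ι (toLex ((0 : Fin m), (0 : Fin m))) := by
        rintro ⟨ab, hab⟩
        have h1 := hιinj hab
        have h2 := congrArg (fun x : MatIdx m => (((ofLex x).1 : Fin m) : ℕ)) h1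
        simp only [G₀, ofLex_toLex, Fin.val_zero] at h2
        have h3 := (e₀ ab.1).2
        omega
      have : ρ (ι (toLex ((0 : Fin m), (0 : Fin m)))) = y := by
        show (if h : ∃ ab, ι (G₀ ab) = ι (toLex ((0 : Fin m), (0 : Fin m))) then G₁ h.choose else y) = y
        rw [dif_neg hne]
      rw [this]
    · subst heq
      simp
  -- the two padded permanents along the enumerations
  have hpp₀ : paddedPerFormLex ℂ n m =
      (X (toLex ((0 : Fin m), (0 : Fin m))) : MvPolynomial (MatIdx m) ℂ) ^ (m - n) * rename G₀ (perPoly (Fin n) ℂ) :=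
    dg_paddedPerFormLex_eq n m e₀
  have hpp₁ : paddedPerFormLex ℂ n (m + j) = X y ^ (m + j - n) * rename G₁ (perPoly (Fin n) ℂ) :=
    dg_paddedPerFormLex_eq n (m + j) e₁
  have hcomp : (ρ ∘ ι) ∘ G₀ = G₁ := funext fun ab => hρG ab
  have key : rename ρ (X y ^ j * rename ι (paddedPerFormLex ℂ n m)) = paddedPerFormLex ℂ n (m + j) := by
    rw [hpp₀, map_mul, map_pow, rename_X, hρy, rename_rename, map_mul, map_pow, rename_X,
      Function.comp_apply, hρx, rename_rename, hcomp, hpp₁, ← mul_assoc, ← pow_add]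
    have hexp : j + (m - n) = m + j - n := by omega
    rw [hexp]
  rw [← key]
  exact rename_mem_endOrbit ρ _

/-! ## Monotonicity of border determinantal membership in the matrix size -/

/-- **Membership is monotone in the level (lexicographic variables).**  For `n ≤ m` and every `j`:
`X₀₀^{m-n} per_n ∈ Δ(det_m) ⇒ X₀₀^{m+j-n} per_n ∈ Δ(det_{m+j})`.  Chain: the fresh padding
`X₀₀^j · ι(X₀₀^{m-n} per_n)` lies in `Δ(X₀₀^j · ι(det_m))` (`fresh_padding_mem_orbitClosure_of_mem`),
which lies in `Δ(det_{m+j})` (`X_pow_mul_rename_detFormLex_mem_orbitClosure`, Mulmuley–Sohoni Prop. 4.4),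
and `X₀₀^{m+j-n} per_n` is a relabeling of the fresh padding (`paddedPerFormLex_mem_endOrbit_fresh_padding`,
`End · q ⊆ Δ(q)`).  [Mulmuley–Sohoni 2001 §4 (Prop. 4.4); Landsberg 2017 §6; folklore] -/
theorem paddedPerFormLex_mem_orbitClosure_detFormLex_mono {n m : ℕ} [NeZero m] (hnm : n ≤ m) (j : ℕ)
    [NeZero (m + j)] (h : paddedPerFormLex ℂ n m ∈ orbitClosure (detFormLex ℂ m)) :
    paddedPerFormLex ℂ n (m + j) ∈ orbitClosure (detFormLex ℂ (m + j)) := by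
  rcases Nat.eq_zero_or_pos j with hj0 | hj
  · subst hj0
    exact h
  · have hy := toLex_zero_not_mem_segEmb (m := m) (j := j) hj
    have h1 := fresh_padding_mem_orbitClosure_of_mem (Nat.le_add_right m j) _ hy j h
    have h2 := X_pow_mul_rename_detFormLex_mem_orbitClosure m j (segEmb (Nat.le_add_right m j))
      (toLex ((0 : Fin (m + j)), (0 : Fin (m + j))))
    have h3 := orbitClosure_subset_of_mem_holds h2 h1
    have h4 := endOrbit_subset_orbitClosure_holds _ (paddedPerFormLex_mem_endOrbit_fresh_padding hnm j hj)
    exact orbitClosure_subset_of_mem_holds h3 h4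

/-- **Border determinantal membership of the padded permanent is monotone in the matrix size**:
for `n ≤ m ≤ m'`, `HasBorderDetRepr ℂ n m → HasBorderDetRepr ℂ n m'`
(`X₀₀^{m-n} per_n ∈ Δ(det_m) ⇒ X₀₀^{m'-n} per_n ∈ Δ(det_{m'})`; transport to the lexicographic
variables by `hasBorderDetRepr_iff_rename`).  [Mulmuley–Sohoni 2001 §4; Landsberg 2017 §6; folklore] -/
theorem hasBorderDetRepr_mono {n m m' : ℕ} [NeZero m] [NeZero m'] (hnm : n ≤ m) (hmm' : m ≤ m')
    (h : HasBorderDetRepr ℂ n m) : HasBorderDetRepr ℂ n m' := by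
  obtain ⟨j, rfl⟩ := Nat.exists_eq_add_of_le hmm'
  exact (hasBorderDetRepr_iff_rename_holds (k := ℂ) n (m + j)).2
    (paddedPerFormLex_mem_orbitClosure_detFormLex_mono hnm j ((hasBorderDetRepr_iff_rename_holds (k := ℂ) n m).1 h))

/-- Contrapositive: **non-membership propagates DOWN in the matrix size** — for `n ≤ m ≤ m'`,
`X₀₀^{m'-n} per_n ∉ Δ(det_{m'}) ⇒ X₀₀^{m-n} per_n ∉ Δ(det_m)`. [this file] -/
theorem not_hasBorderDetRepr_anti {n m m' : ℕ} [NeZero m] [NeZero m'] (hnm : n ≤ m) (hmm' : m ≤ m')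
    (h : ¬ HasBorderDetRepr ℂ n m') : ¬ HasBorderDetRepr ℂ n m :=
  fun h' => h (hasBorderDetRepr_mono hnm hmm' h')

/-- **Border determinantal complexity is a threshold**: for `n ≤ m`,
`HasBorderDetRepr ℂ n m ↔ dc̲(per_n) ≤ m` (`→`: `m` is in the defining set of the infimum; `←`: the
infimum is attained, `hasBorderDetRepr_borderDetComplexityPer`, and membership is monotone).
[Mulmuley–Sohoni 2001 §4; Landsberg 2017 §6] -/
theorem hasBorderDetRepr_iff_borderDetComplexityPer_le {n m : ℕ} [NeZero m] (hnm : n ≤ m) :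
    HasBorderDetRepr ℂ n m ↔ borderDetComplexityPer ℂ n ≤ m := by
  constructor
  · intro h
    exact Nat.sInf_le ⟨Nat.pos_of_ne_zero (NeZero.ne m), hnm, h⟩
  · intro h
    obtain ⟨hpos, hle, hmem⟩ := hasBorderDetRepr_borderDetComplexityPer (k := ℂ) n
    haveI : NeZero (borderDetComplexityPer ℂ n) := NeZero.of_pos hpos
    exact hasBorderDetRepr_mono hle h hmem

/-! ## Consequences for the window statements of the route -/

/-- **A valuative flip certifies non-membership at every level below it**: if the body of
`ValuativeFlip` holds at `(n, m)` then `X₀₀^{m'-n} per_n ∉ Δ(det_{m'})` for every `n ≤ m' ≤ m`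
(`ValuativeBound` + the multiplicity-obstruction principle at level `m`, then `not_hasBorderDetRepr_anti`).
[this route: `ValuativeBound_proof`, `GctMultPrinciple_proof`; this file] -/
theorem not_hasBorderDetRepr_of_flipBody_of_le {n m m' : ℕ} [NeZero m] [NeZero m']
    (hnm' : n ≤ m') (hm'm : m' ≤ m)
    (h :
      ∃ (U : Submodule ℂ (MatIdx m → ℂ)) (r δ : ℕ) (lam : Nat.Partition (m * δ)),
            (∀ u ∈ U, (Matrix.of fun a b : Fin m => u (toLex (a, b))).rank ≤ r) ∧ lam.parts.card ≤ m * m ∧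
              Module.finrank ℂ ↥(MvPolynomial.homogeneousSubmodule (MatIdx m × MatIdx m) ℂ (m * δ) ⊓
                  ((MvPolynomial.vanishingIdeal ℂ
                      {p : MatIdx m × MatIdx m → ℂ | ∀ j : MatIdx m, (fun i => p (j, i)) ∈ U}) ^ (δ * (m - r))).restrictScalars ℂ ⊓
                  (⨅ (M : Matrix (MatIdx m) (MatIdx m) ℂ)
                    (_ : linSubst (MatIdx m) ℂ M (detFormLex ℂ m) = detFormLex ℂ m),
                    LinearMap.ker ((MvPolynomial.aeval fun p : MatIdx m × MatIdx m =>
                        ∑ l : MatIdx m, M l p.2 •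
                          (MvPolynomial.X (p.1, l) : MvPolynomial (MatIdx m × MatIdx m) ℂ)).toLinearMap -
                      (LinearMap.id : MvPolynomial (MatIdx m × MatIdx m) ℂ →ₗ[ℂ] MvPolynomial (MatIdx m × MatIdx m) ℂ))) ⊓
                  (⨅ (g : Matrix.GeneralLinearGroup (MatIdx m) ℂ) (_ : IsUpperTriangular g),
                    LinearMap.ker ((MvPolynomial.aeval fun p : MatIdx m × MatIdx m =>
                        ∑ l : MatIdx m, ((g⁻¹ : Matrix.GeneralLinearGroup (MatIdx m) ℂ) :
                          Matrix (MatIdx m) (MatIdx m) ℂ) p.1 l •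
                            (MvPolynomial.X (l, p.2) : MvPolynomial (MatIdx m × MatIdx m) ℂ)).toLinearMap -
                      weightChar ((Weight.dualOfPartition (m * m) lam).toMatIdx : Weight (MatIdx m)) g •
                        (LinearMap.id : MvPolynomial (MatIdx m × MatIdx m) ℂ →ₗ[ℂ] MvPolynomial (MatIdx m × MatIdx m) ℂ)))) <
                orbitMultiplicity ℂ (paddedPerFormLex ℂ n m) m
                  ((Weight.dualOfPartition (m * m) lam).toMatIdx : Weight (MatIdx m))) :
    ¬ HasBorderDetRepr ℂ n m' := by
  obtain ⟨U, r, δ, lam, hU, hcard, hlt⟩ := h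
  have hnot : ¬ HasBorderDetRepr ℂ n m :=
    GctMultPrinciple_proof n m _ (hnm'.trans hm'm)
      (lt_of_le_of_lt (ValuativeBound.ValuativeBound_proof m U r hU δ lam hcard) hlt)
  exact not_hasBorderDetRepr_anti hnm' hm'm hnot

/-- **The border thesis is its top edge.**  The hypothesis of the route's bridge `GctToVH` —
non-membership `X₀₀^{m-n} per_n ∉ Δ(det_m)` at EVERY position of every quasi-polynomial window — is
equivalent to non-membership at the single TOP position `m = W_c(n) = 2^((log₂ n + c)^c)` of each
window column (for the columns that are nonempty, `n ≤ W_c(n)`): membership is monotone in `m`.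
[this file] -/
theorem forall_window_not_hasBorderDetRepr_iff_top :
    (∀ c : ℕ, ∃ n₀ : ℕ, ∀ n ≥ n₀, ∀ (m : ℕ) [NeZero m], n ≤ m → m ≤ 2 ^ ((Nat.log 2 n + c) ^ c) →
        paddedPerPoly ℂ n m ∉ orbitClosure (detPoly (Fin m) ℂ)) ↔
      ∀ c : ℕ, ∃ n₀ : ℕ, ∀ n ≥ n₀, n ≤ 2 ^ ((Nat.log 2 n + c) ^ c) →
        ¬ HasBorderDetRepr ℂ n (2 ^ ((Nat.log 2 n + c) ^ c)) := by
  constructor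
  · intro H c
    obtain ⟨n₀, hn₀⟩ := H c
    exact ⟨n₀, fun n hn hnW => hn₀ n hn _ hnW le_rfl⟩
  · intro H c
    obtain ⟨n₀, hn₀⟩ := H c
    exact ⟨n₀, fun n hn m _ hnm hm hmem => hn₀ n hn (hnm.trans hm) (hasBorderDetRepr_mono hnm hm hmem)⟩

/-- **Valiant's hypothesis from ONE non-membership per inner size.**  If for every `c`, for all large
`n`, the padded permanent `X₀₀^(W_c(n)-n) per_n` is not a degeneration of `det_{W_c(n)}` at the top
`W_c(n) = 2^((log₂ n + c)^c)` of the window, then `VP ≠ VNP` (the route's bridge `GctToVH_holds` after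
`forall_window_not_hasBorderDetRepr_iff_top`). [this route; this file] -/
theorem valiantsHypothesis_of_top_not_hasBorderDetRepr
    (H : ∀ c : ℕ, ∃ n₀ : ℕ, ∀ n ≥ n₀, n ≤ 2 ^ ((Nat.log 2 n + c) ^ c) →
        ¬ HasBorderDetRepr ℂ n (2 ^ ((Nat.log 2 n + c) ^ c))) : _root_.ValiantsHypothesis :=
  Summit.ValiantsHypothesis.ValiantsHypothesis.Theses.ValuativeGCT.GctToVH_holds
    (forall_window_not_hasBorderDetRepr_iff_top.mpr H)

/-- **Valiant's hypothesis from a super-quasi-polynomial BORDER determinantal complexity of the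
permanent, eventually in `n`**: if for every `c`, `W_c(n) < dc̲(per_n)` for all large `n`, then
`VP ≠ VNP` (`hasBorderDetRepr_iff_borderDetComplexityPer_le` turns `W_c(n) < dc̲(per_n)` into
non-membership at the top of the window). [Mulmuley–Sohoni 2001 §4; this route; this file] -/
theorem valiantsHypothesis_of_window_lt_borderDetComplexityPer
    (H : ∀ c : ℕ, ∃ n₀ : ℕ, ∀ n ≥ n₀, 2 ^ ((Nat.log 2 n + c) ^ c) < borderDetComplexityPer ℂ n) :
    _root_.ValiantsHypothesis := by
  refine valiantsHypothesis_of_top_not_hasBorderDetRepr fun c => ?_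
  obtain ⟨n₀, hn₀⟩ := H c
  refine ⟨n₀, fun n hn hnW hmem => ?_⟩
  have hle := (hasBorderDetRepr_iff_borderDetComplexityPer_le hnW).1 hmem
  exact absurd (hn₀ n hn) (not_lt.mpr hle)

/-! ## Appendix (same seat): `Ω = ⋃_m Δ(det_m)` is closed under padding — the border analogue of `HasDetRepr.mono` -/

/-- **Fresh paddings of degenerations of `det_m` are degenerations of `det_{m+j}`**:
`p ∈ Δ(det_m) ⇒ X_y^j · ι(p) ∈ Δ(det_{m+j})` for every `y` off the segment
(`fresh_padding_mem_orbitClosure_of_mem` + `X_pow_mul_rename_detFormLex_mem_orbitClosure`).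
[Mulmuley–Sohoni 2001 §4; this file] -/
theorem fresh_padding_mem_orbitClosure_detFormLex_of_mem {m : ℕ} (j : ℕ) [NeZero (m + j)]
    (y : MatIdx (m + j)) (hy : ∀ r : MatIdx m, segEmb (Nat.le_add_right m j) r ≠ y)
    {p : MvPolynomial (MatIdx m) ℂ} (hp : p ∈ orbitClosure (detFormLex ℂ m)) :
    X y ^ j * rename (segEmb (Nat.le_add_right m j)) p ∈ orbitClosure (detFormLex ℂ (m + j)) :=
  orbitClosure_subset_of_mem_holds
    (X_pow_mul_rename_detFormLex_mem_orbitClosure m j (segEmb (Nat.le_add_right m j)) y)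
    (fresh_padding_mem_orbitClosure_of_mem (Nat.le_add_right m j) y hy j hp)

/-- **Degenerations of the determinant stay degenerations after padding**: for EVERY form `p` with
`p ∈ Δ(det_m)` and every `j ≥ 1`, `paddedForm m j p = X_top^j · ι(p) ∈ Δ(det_{m+j})` — border membership
suffices where Ikenmeyer–Panova's `paddedForm_mem_orbitClosure_detFormLex` needs `dc(p) ≤ m + j`
(pad with the fresh letter `X₀₀`, then move it onto the top variable, `exists_linSubst_fresh_to_top`).
[Mulmuley–Sohoni 2001 §4; this file] -/
theorem paddedForm_mem_orbitClosure_detFormLex_of_mem {m : ℕ} (j : ℕ) [NeZero (m + j)] (hj : 1 ≤ j)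
    {p : MvPolynomial (MatIdx m) ℂ} (hp : p ∈ orbitClosure (detFormLex ℂ m)) :
    paddedForm m j p ∈ orbitClosure (detFormLex ℂ (m + j)) := by
  have hy := toLex_zero_not_mem_segEmb (m := m) (j := j) hj
  obtain ⟨S, hS⟩ := exists_linSubst_fresh_to_top (m := m) (j := j) _ hy
  rw [← hS p]
  exact linSubst_mem_orbitClosure_of_mem (fresh_padding_mem_orbitClosure_detFormLex_of_mem j _ hy hp) S

end

end Summit.ValiantsHypothesis.ValiantsHypothesis.Theorems.ValuativeFlip
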